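import Literature.Combinatorics.Optimization.ShellLawPopulationMixture
import Literature.Probability.Distributions.BinomialSmoothingProfile
import Summits.PneNP.PneNP.Theorems.ChebyshevTracialDesignVirtualPositivityCriterion
import HarnessLib

/-!
# Cell pnp-psdrank, route `ChebyshevTracialDesign`: SMALL BLOCKS WITHOUT INTERNAL EDGES HAVE NONNEGATIVE VIRTUAL LAW
# ON THE WHOLE SUPPORT — (O1) with ZERO defect, no window, no tail (crux `TracialDecayExp20`, stmt-PneNP-19878)

Brick (T-K) (engine seat g23; eng MEMO-22 §6–§7). Per matching `M` (a fixed-point-free involution `π` on the `n = 2N` vertices)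
and block `H` of `H`-type `(0, b, N−b)` — NO matching edge inside `H`, `b` edges crossing it — the shell law of the block statistic
`X = |U ∩ H|` at cut `t = 2s₀+1` and level `c` is a BINOMIAL MIXTURE in the population parameter of ONE hypergeometric kernel
(lit g36's `ShellLawPopulationMixture.shellLaw_odd_eq_binomialProfile` + `shellLaw_zero_eq`:
`law_c(y) = Σ_{w≤c} C(c,w)2^{−c}·Hyp_N(s+w; b)(y)`, `s = (t−c)/2`), the `k`-fold level differences are EXACTLY `4^{−k}` times the
binomial average of the `2k`-fold differences of the kernel in `K` (`BinomialSmoothingProfile.fwdDiff_iter_binomialProfile`), and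
the kernel `K ↦ Hyp_N(K;b)(y) = C(b,y)(−1)^{b−y}/(N)_b·Π_{i<y}(K−i)Π_{j<b−y}(K−(N−j))` is a product of `b` linear factors whose roots
lie in `[0,b) ∪ (N−b, N]` (`hypergeomPopulationKernel_eq_prod`), hence `(b/R)^{2k}e^{3bk/R}`-smooth on the window `K ≈ t/2`
(`abs_laplaceQuarter_iter_prodKernel_le`, from `Literature.Algebra.Polynomial.RealRootedFarDifferences`). Consequently:

* §1 `geom_sum_Ico_le_one` — the numerics `Σ_{k=1}^{D} q^k ≤ 1` for `q ≤ ½` (`C(2k,k)/4^k ≤ 1` is brick 121's `centralBinom_div_four_pow_le_one`).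
* §2 **`smallBlock_relSmooth`** — THE BRICK-121 CRITERION AT EVERY POINT: for `R ≥ 1` with `R + 3D + b ≤ s₀ + 1`, `R + 3D + b + s₀ ≤ N`
  and `(b/R)²·e^{3b/R} ≤ 2`: `Σ_{k=1}^{D} (C(2k,k)/4^k)·|Δ^k[j ↦ law_{2j+1}(y)](0)| ≤ law_1(y)` for EVERY `y ∈ [0, t]`.
* §3 **`smallBlock_virtualValue_nonneg`** — hence (brick 121 `shellProfile_newton_eval_zero_ge` with the window `B = [0,t]`, empty tail)
  `N^{odd}_D[c ↦ E_{Shell_c(M)}[ψ₀(|U∩H|)]](0) ≥ 0` for EVERY `0 ≤ ψ₀ ≤ G`: the open point (O1) of prover MEMO-25 §4 holds with ZERO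
  defect for such blocks — the main term of brick 120's crossing-plane reduction is `≥ 0` exactly.
READING (eng MEMO-22 §1/§6): at the design's balanced cut (`s₀ ≈ N/2`) the hypotheses read `b ≲ 0.2·N`, `D ≲ N/6`: every block of at
most a fifth of the vertices whose matching has no internal edge (the typical type for `|H| ≪ √n`; the sublinear regime of eng
MEMO-21 §12 / MEMO-22 §1 that bricks 109–116 (juntas, `|H| = O(D)`) and 124/125 (linear blocks with three type margins) leave uncovered).
WHAT THIS FILE DOES NOT DO: types with internal edges `a ≥ 1` (the A-state mixture (K0), lit's `card_shellIn_split_class`, is the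
route), the remainders of brick 120, the M-average; anything on `TracialDecayExp20` itself, psd rank of P_PM(K_n), or P vs NP.
[cite: Rothvoss2017, §2 (PDF p. 6)] [cite: ChattamvelliShanmugam2020, §7.4 Table 7.1] [cite: Agarwal2000DifferenceEquations, Remark 1.8.1]
Stature: support/instrument (kernel lane, no defs, axioms standard). Supports stmt-PneNP-19878.
-/

set_option linter.dupNamespace false -- `Summit.PneNP.PneNP.…`: summit = sub-problem (D-0017)

noncomputable section

namespace Summit.PneNP.PneNP.Theorems.ChebyshevTracialDesignSmallBlockVirtualPositivity

open Finset Literature.Combinatorics.Optimization Literature.Combinatorics.Optimization.ShellStep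
open Literature.Combinatorics.StablePolynomials (hyperGen coeff_hyperGen)
open Literature.Probability.Distributions.BinomialSmoothing
open Summit.PneNP.PneNP.Theorems.ChebyshevTracialDesignVirtualPositivityCriterion (shellLaw_nonneg'
  shellProfile_newton_eval_zero_ge centralBinom_div_four_pow_le_one)

/-! ### §1 Numerics -/

/-- `Σ_{k=1}^{D} q^k ≤ 1` for `0 ≤ q ≤ ½`. [cite: Agarwal2000DifferenceEquations, Remark 1.8.1] -/
theorem geom_sum_Ico_le_one {q : ℝ} (hq0 : 0 ≤ q) (hq : q ≤ 1 / 2) (D : ℕ) :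
    ∑ k ∈ Ico 1 (D + 1), q ^ k ≤ 1 := by
  have hq1 : q < 1 := by linarith
  rw [geom_sum_Ico hq1.ne (by omega : 1 ≤ D + 1), div_le_iff_of_neg (by linarith), pow_one]
  have hqD : 0 ≤ q ^ (D + 1) := pow_nonneg hq0 _
  linarith

/-! ### §2 The criterion at every point for a block without internal edges -/

section Main

variable {n : ℕ} {π : Fin n → Fin n} (hπ : ∀ v, π (π v) = v) (hπ' : ∀ v, π v ≠ v)
include hπ hπ'

/-- **THE BRICK-121 CRITERION HOLDS AT EVERY POINT FOR A SMALL BLOCK WITHOUT INTERNAL EDGES.** Let `π` be a perfect matching of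
the `2N` vertices, `H` a block with no matching edge inside (`a = 0`) and `b` crossing edges, `t = 2s₀+1` the cut, `D` the degree,
and `R ≥ 1` an integer with `R + 3D + b ≤ s₀ + 1`, `R + 3D + b + s₀ ≤ N` and `(b/R)²·e^{3b/R} ≤ 2`. Then for every `y ∈ [0,t]`:
`Σ_{k=1}^{D} (C(2k,k)/4^k)·|Δ^k[j ↦ law_{2j+1}(y)](0)| ≤ law_1(y)` (`law_c(y) = shellLaw π univ H t c y`).
(Population mixture: `law_{2j+1}(y)` is the binomial smoothing profile of the kernel `K ↦ C(b,y)(−1)^{b−y}/(N)_b·Π_{i<b}(K − r_i)`,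
`r_i ∈ [0,b) ∪ (N−b,N]`; its `k`-fold level difference is the binomial average of `(¼∇²_K)^k` of the kernel; far-roots smoothness
`|(¼∇²)^kφ(K₁)| ≤ 4^{−k}(b/R)^{2k}e^{3bk/R}φ(K₁)` at `K₁ ∈ {s₀, s₀+1}`; `C(2k,k)/4^k ≤ 1` and a geometric sum.)
[cite: Rothvoss2017, §2 (PDF p. 6)] [cite: ChattamvelliShanmugam2020, §7.4 Table 7.1] [cite: Agarwal2000DifferenceEquations, Remark 1.8.1] -/
theorem smallBlock_relSmooth {N : ℕ} (hn : (univ : Finset (Fin n)).card = 2 * N) (H : Finset (Fin n))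
    (h0 : (reps π (vAA π univ H)).card = 0) {b : ℕ} (hb : (reps π (vBH π univ H ∪ vBN π univ H)).card = b)
    {s₀ D R : ℕ} (hR : 1 ≤ R) (hR1 : R + 3 * D + b ≤ s₀ + 1) (hR2 : R + 3 * D + b + s₀ ≤ N)
    (hq : ((b : ℝ) / R) ^ 2 * Real.exp (3 * b / R) ≤ 2) :
    ∀ y ∈ Icc (0 : ℤ) ((2 * s₀ + 1 : ℕ) : ℤ),
      ∑ k ∈ Ico 1 (D + 1), (((2 * k).choose k : ℕ) : ℝ) / (4 : ℝ) ^ k *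
          |(fwdDiff (1 : ℕ))^[k] (fun j => shellLaw π univ H (2 * s₀ + 1) (2 * j + 1) y) 0| ≤
        shellLaw π univ H (2 * s₀ + 1) 1 y := by
  classical
  intro y hy
  obtain ⟨m, rfl⟩ : ∃ m : ℕ, y = (m : ℤ) := Int.eq_ofNat_of_zero_le (mem_Icc.1 hy).1
  have hS : ∀ v ∈ (univ : Finset (Fin n)), π v ∈ univ := fun v _ => mem_univ _
  have hA := noHH_of_card_reps_vAA_eq_zero hπ hπ' hS H h0
  -- the type: `a = 0`, `b` mixed, `d = N − b`
  have hd : (reps π (vDD π univ H)).card = N - b := by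
    have h2 := two_mul_typeReps_eq_card hπ hπ' hS H
    rw [h0, hb, hn] at h2
    omega
  have hbN : b ≤ N := by omega
  have hRpos : (0 : ℝ) < R := by exact_mod_cast hR
  /- ───── the kernel `ψ(K) = c·Π_{i<b}(K − r_i)` ───── -/
  obtain ⟨root, hroot⟩ : ∃ f : ℕ → ℝ, f = fun i => if i < m then (i : ℝ) else (N : ℝ) - ((i - m : ℕ) : ℝ) := ⟨_, rfl⟩
  obtain ⟨c, hc⟩ : ∃ e : ℝ, e = ((b.choose m : ℕ) : ℝ) * (-1) ^ (b - m) / N.descFactorial b := ⟨_, rfl⟩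
  obtain ⟨ψ, hψ⟩ : ∃ g : ℤ → ℝ, g = fun K : ℤ => c * ∏ i ∈ range b, (((K : ℤ) : ℝ) - root i) := ⟨_, rfl⟩
  -- (S1) the level-`0` laws on the window are the kernel
  have hker : ∀ K : ℤ, (s₀ : ℤ) - D ≤ K → K ≤ (s₀ : ℤ) + D + 1 →
      shellLaw π univ H (2 * K.toNat) 0 (m : ℤ) = ψ K := by
    intro K hK1 hK2
    have hK0 : 0 ≤ K := by
      have : (D : ℤ) ≤ s₀ := by exact_mod_cast (show D ≤ s₀ by omega)
      linarith
    obtain ⟨Kn, rfl⟩ : ∃ Kn : ℕ, K = (Kn : ℤ) := Int.eq_ofNat_of_zero_le hK0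
    rw [Int.toNat_natCast]
    have hKn1 : b ≤ Kn := by
      have : ((s₀ : ℤ)) - D ≤ Kn := hK1
      have h' : (s₀ : ℤ) ≤ Kn + D := by linarith
      have h'' : s₀ ≤ Kn + D := by exact_mod_cast h'
      omega
    have hKn2 : Kn + b ≤ N := by
      have h' : (Kn : ℤ) ≤ s₀ + D + 1 := hK2
      have h'' : Kn ≤ s₀ + D + 1 := by exact_mod_cast h'
      omega
    rw [shellLaw_zero_eq hπ hπ' hS hn H h0 Kn m, hb, hd, coeff_hyperGen, hψ, hc, hroot]
    by_cases hm : m ≤ b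
    · rw [if_pos (by omega : m ≤ Kn)]
      have hk := hypergeomPopulationKernel_eq_prod (N := N) hm hKn1 hKn2
      push_cast at hk ⊢
      rw [hk]
    · have hz : b.choose m = 0 := Nat.choose_eq_zero_of_lt (by omega)
      simp [hz]
  -- (S2) the odd-level laws are the binomial smoothing profile of `ψ`
  have hprof : ∀ j : ℕ, j ≤ D →
      shellLaw π univ H (2 * s₀ + 1) (2 * j + 1) (m : ℤ) =
        ∑ w ∈ range (2 * j + 2), ((2 * j + 1).choose w : ℝ) / 2 ^ (2 * j + 1) * ψ ((s₀ : ℤ) - j + w) := by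
    intro j hj
    rw [shellLaw_odd_eq_binomialProfile hπ hπ' hS hn hA (by omega : j ≤ s₀) (by omega : s₀ + j + 1 ≤ N) (m : ℤ)]
    refine sum_congr rfl fun w hw => ?_
    have hw' : w ≤ 2 * j + 1 := Nat.lt_succ_iff.1 (mem_range.1 hw)
    simp only
    rw [hker ((s₀ : ℤ) - j + w) (by linarith [(show (j : ℤ) ≤ D by exact_mod_cast hj), (Int.natCast_nonneg w)])
      (by
        have : (w : ℤ) ≤ 2 * j + 1 := by exact_mod_cast hw'
        have : (j : ℤ) ≤ D := by exact_mod_cast hj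
        linarith)]
  -- (S3) hence the same forward differences at `0` (locality: only `j ≤ k ≤ D` is sampled)
  have hΔ : ∀ k : ℕ, k ≤ D →
      (fwdDiff (1 : ℕ))^[k] (fun j => shellLaw π univ H (2 * s₀ + 1) (2 * j + 1) (m : ℤ)) 0 =
        (fwdDiff (1 : ℕ))^[k] (fun j : ℕ => ∑ w ∈ range (2 * j + 2),
          ((2 * j + 1).choose w : ℝ) / 2 ^ (2 * j + 1) * ψ ((s₀ : ℤ) - j + w)) 0 := by
    intro k hk
    rw [fwdDiff_iter_eq_sum_shift, fwdDiff_iter_eq_sum_shift]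
    refine sum_congr rfl fun i hi => ?_
    have hi' : i ≤ k := Nat.lt_succ_iff.1 (mem_range.1 hi)
    congr 1
    simp only [zero_add, smul_eq_mul, mul_one]
    exact hprof i (hi'.trans hk)
  -- (S4) far-roots smoothness of the kernel at `K₁ ∈ {s₀, s₀+1}`
  have hψpoly : ∀ K : ℤ, ψ K = c * (∏ i ∈ range b, (Polynomial.X - Polynomial.C (root i))).eval (K : ℝ) := by
    intro K; rw [hψ, Polynomial.eval_prod]; simp
  have hψnn : ∀ K₁ ∈ ({(s₀ : ℤ), (s₀ : ℤ) + 1} : Finset ℤ), 0 ≤ ψ K₁ := by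
    intro K₁ hK₁
    rw [mem_insert, mem_singleton] at hK₁
    rcases hK₁ with rfl | rfl
    · rw [← hker (s₀ : ℤ) (by linarith [(Int.natCast_nonneg D)]) (by linarith [(Int.natCast_nonneg D)])]
      exact shellLaw_nonneg' _ _ _ _ _
    · rw [← hker ((s₀ : ℤ) + 1) (by linarith [(Int.natCast_nonneg D)]) (by linarith [(Int.natCast_nonneg D)])]
      exact shellLaw_nonneg' _ _ _ _ _
  have hfar : ∀ K₁ ∈ ({(s₀ : ℤ), (s₀ : ℤ) + 1} : Finset ℤ), ∀ k : ℕ, k ≤ D →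
      ∀ i, i < b → (R : ℝ) + 3 * k ≤ |(K₁ : ℝ) - root i| := by
    intro K₁ hK₁ k hk i hi
    have hK₁lo : (s₀ : ℝ) ≤ (K₁ : ℝ) ∧ (K₁ : ℝ) ≤ s₀ + 1 := by
      rw [mem_insert, mem_singleton] at hK₁
      rcases hK₁ with rfl | rfl
      · push_cast; constructor <;> linarith
      · push_cast; constructor <;> linarith
    have hk3 : (3 : ℝ) * k ≤ 3 * D := by
      have : (k : ℝ) ≤ D := by exact_mod_cast hk
      linarith
    have hR1' : (R : ℝ) + 3 * D + b ≤ s₀ + 1 := by exact_mod_cast hR1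
    have hR2' : (R : ℝ) + 3 * D + b + s₀ ≤ N := by exact_mod_cast hR2
    have hib : (i : ℝ) + 1 ≤ b := by exact_mod_cast hi
    rw [hroot]
    simp only
    split_ifs with him
    · -- root `i ≤ b − 1` below the window
      rw [abs_of_nonneg (by linarith [hK₁lo.1])]
      linarith [hK₁lo.1]
    · -- root `N − (i − m) ≥ N − b + 1` above the window
      have him' : ((i - m : ℕ) : ℝ) ≤ i := by
        have : i - m ≤ i := Nat.sub_le _ _
        exact_mod_cast this
      rw [abs_of_nonpos (by linarith [hK₁lo.2])]
      linarith [hK₁lo.2]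
  have hbd : ∀ k ∈ Ico 1 (D + 1), ∀ K₁ ∈ ({(s₀ : ℤ), (s₀ : ℤ) + 1} : Finset ℤ),
      |((fun φ : ℤ → ℝ => fun K : ℤ => (φ (K - 1) - 2 * φ K + φ (K + 1)) / 4)^[k] ψ) K₁| ≤
        ((1 / 4 : ℝ) ^ k * (((b : ℝ) / R) ^ (2 * k) * Real.exp (b * (2 * k : ℕ) / R)) * Real.exp (b * k / R)) * ψ K₁ := by
    intro k hk K₁ hK₁
    have hkD : k ≤ D := by have := (mem_Ico.1 hk).2; omega
    have h := abs_laplaceQuarter_iter_prodKernel_le root b k c hRpos ψ hψpoly K₁ (hfar K₁ hK₁ k hkD)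
    rwa [abs_of_nonneg (hψnn K₁ hK₁)] at h
  -- (S5) transfer to the profile at `j = 0`
  have hT := sum_mul_abs_fwdDiff_iter_binomialProfile_zero_le ψ (s₀ : ℤ) D
    (fun k => (((2 * k).choose k : ℕ) : ℝ) / (4 : ℝ) ^ k)
    (fun k => (1 / 4 : ℝ) ^ k * (((b : ℝ) / R) ^ (2 * k) * Real.exp (b * (2 * k : ℕ) / R)) * Real.exp (b * k / R))
    (fun k => by positivity) hbd
  -- (S6) the weighted sum of the smoothness constants is `≤ 1`
  obtain ⟨q, hqdef⟩ : ∃ e : ℝ, e = (1 / 4 : ℝ) * ((b : ℝ) / R) ^ 2 * Real.exp (3 * b / R) := ⟨_, rfl⟩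
  have hq0 : 0 ≤ q := by rw [hqdef]; positivity
  have hq2 : q ≤ 1 / 2 := by rw [hqdef]; linarith
  have hρ : ∀ k : ℕ, (1 / 4 : ℝ) ^ k * (((b : ℝ) / R) ^ (2 * k) * Real.exp (b * (2 * k : ℕ) / R)) *
      Real.exp (b * k / R) = q ^ k := by
    intro k
    have e1 : ((b : ℝ) / R) ^ (2 * k) = (((b : ℝ) / R) ^ 2) ^ k := pow_mul _ 2 k
    have e2 : Real.exp (b * ((2 * k : ℕ) : ℝ) / R) * Real.exp (b * k / R) = Real.exp (3 * b / R) ^ k := by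
      rw [← Real.exp_add, ← Real.exp_nat_mul]
      congr 1
      push_cast
      ring
    rw [hqdef, mul_pow, mul_pow, e1, ← e2]
    ring
  have hsum1 : ∑ k ∈ Ico 1 (D + 1), (((2 * k).choose k : ℕ) : ℝ) / (4 : ℝ) ^ k *
      ((1 / 4 : ℝ) ^ k * (((b : ℝ) / R) ^ (2 * k) * Real.exp (b * (2 * k : ℕ) / R)) * Real.exp (b * k / R)) ≤ 1 := by
    calc _ ≤ ∑ k ∈ Ico 1 (D + 1), q ^ k := by
          refine sum_le_sum fun k _ => ?_
          rw [hρ k]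
          calc (((2 * k).choose k : ℕ) : ℝ) / (4 : ℝ) ^ k * q ^ k ≤ 1 * q ^ k :=
                mul_le_mul_of_nonneg_right (centralBinom_div_four_pow_le_one k) (pow_nonneg hq0 k)
            _ = q ^ k := one_mul _
      _ ≤ 1 := geom_sum_Ico_le_one hq0 hq2 D
  -- (S7) assemble
  have hprof0 : (fun j : ℕ => ∑ w ∈ range (2 * j + 2), ((2 * j + 1).choose w : ℝ) / 2 ^ (2 * j + 1) *
      ψ ((s₀ : ℤ) - j + w)) 0 = shellLaw π univ H (2 * s₀ + 1) 1 (m : ℤ) := by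
    show (∑ w ∈ range (2 * 0 + 2), ((2 * 0 + 1).choose w : ℝ) / 2 ^ (2 * 0 + 1) *
      ψ ((s₀ : ℤ) - (0 : ℕ) + w)) = _
    exact (hprof 0 (Nat.zero_le _)).symm
  have hnn1 : 0 ≤ shellLaw π univ H (2 * s₀ + 1) 1 (m : ℤ) := shellLaw_nonneg' _ _ _ _ _
  calc ∑ k ∈ Ico 1 (D + 1), (((2 * k).choose k : ℕ) : ℝ) / (4 : ℝ) ^ k *
          |(fwdDiff (1 : ℕ))^[k] (fun j => shellLaw π univ H (2 * s₀ + 1) (2 * j + 1) (m : ℤ)) 0|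
      = ∑ k ∈ Ico 1 (D + 1), (((2 * k).choose k : ℕ) : ℝ) / (4 : ℝ) ^ k *
          |(fwdDiff (1 : ℕ))^[k] (fun j : ℕ => ∑ w ∈ range (2 * j + 2),
            ((2 * j + 1).choose w : ℝ) / 2 ^ (2 * j + 1) * ψ ((s₀ : ℤ) - j + w)) 0| := by
        refine sum_congr rfl fun k hk => ?_
        rw [hΔ k (by have := (mem_Ico.1 hk).2; omega)]
    _ ≤ _ := hT
    _ ≤ 1 * shellLaw π univ H (2 * s₀ + 1) 1 (m : ℤ) := by
        rw [hprof0]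
        exact mul_le_mul_of_nonneg_right hsum1 hnn1
    _ = _ := one_mul _

/-! ### §3 The virtual value of every nonnegative block statistic is nonnegative -/

/-- **SMALL BLOCKS WITHOUT INTERNAL EDGES: THE VIRTUAL VALUE OF EVERY NONNEGATIVE BLOCK STATISTIC IS `≥ 0`.** Under the hypotheses
of `smallBlock_relSmooth` (matching `π` on `2N` vertices, block `H` with `a = 0`, `b` crossing edges, cut `t = 2s₀+1`, degree `D`,
`R ≥ 1`, `R + 3D + b ≤ s₀+1`, `R + 3D + b + s₀ ≤ N`, `(b/R)²e^{3b/R} ≤ 2`), for every `ψ₀` with `0 ≤ ψ₀ ≤ G` on `[0,t]`: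
`N^{odd}_D[c ↦ E_{Shell_c(M)}[ψ₀(|U∩H|)]](0) ≥ 0` — brick 121 `shellProfile_newton_eval_zero_ge` with the window `[0,t]` itself
(empty tail). This is (O1) of prover MEMO-25 §4 with ZERO defect for such blocks: the main term of brick 120's crossing-plane
reduction is nonnegative. [cite: Rothvoss2017, §2 (PDF p. 6)] [cite: Agarwal2000DifferenceEquations, Remark 1.8.1 (1.8.8)] -/
theorem smallBlock_virtualValue_nonneg {N : ℕ} (hn : (univ : Finset (Fin n)).card = 2 * N) (H : Finset (Fin n))
    (h0 : (reps π (vAA π univ H)).card = 0) {b : ℕ} (hb : (reps π (vBH π univ H ∪ vBN π univ H)).card = b)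
    {s₀ D R : ℕ} (hR : 1 ≤ R) (hR1 : R + 3 * D + b ≤ s₀ + 1) (hR2 : R + 3 * D + b + s₀ ≤ N)
    (hq : ((b : ℝ) / R) ^ 2 * Real.exp (3 * b / R) ≤ 2)
    (ψ₀ : ℤ → ℝ) {G : ℝ} (hψ0 : ∀ x ∈ Icc (0 : ℤ) ((2 * s₀ + 1 : ℕ) : ℤ), 0 ≤ ψ₀ x)
    (hψG : ∀ x ∈ Icc (0 : ℤ) ((2 * s₀ + 1 : ℕ) : ℤ), ψ₀ x ≤ G) :
    0 ≤ (DesignRemainder.newtonPolyOdd D (fun c =>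
        (∑ U ∈ shell π (2 * s₀ + 1) c, ψ₀ ((U ∩ H).card : ℤ)) / ((shell π (2 * s₀ + 1) c).card : ℝ))).eval 0 := by
  have h := shellProfile_newton_eval_zero_ge (π := π) D (2 * s₀ + 1) H ψ₀ hψ0 hψG (Icc (0 : ℤ) ((2 * s₀ + 1 : ℕ) : ℤ))
    (Subset.refl _) (smallBlock_relSmooth hπ hπ' hn H h0 hb hR hR1 hR2 hq)
  rw [sdiff_self, Finset.bot_eq_empty, sum_empty, mul_zero, neg_zero] at h
  exact h

end Main

end Summit.PneNP.PneNP.Theorems.ChebyshevTracialDesignSmallBlockVirtualPositivity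

end
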